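import Mathlib
import Literature.Computability.AlgebraicComplexity.RealTauConjectureDepthFour
import Literature.Computability.AlgebraicComplexity.ArithCircuitProofs
import Literature.Computability.AlgebraicComplexity.PermanentIrreducible

/-!
# `DivisionGap.PerMultiplesHard` (stmt-ValiantsHypothesis-5068), line `uncharged-face-walk`:
board compression (stub `stub_boardCompression`)

A polynomial `a` over `ℝ≥0` on the `n × n` board all of whose exponents are partial permutation
matrices from the row set `S` to the column set `T` (`#S = #T = k`; row margins `𝟙_S`, column
margins `𝟙_T`, zero rows and columns included) moves to the `k × k` board without increasing the
tree's fan-in-two `complexity` and without changing the number of monomials; on the small board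
its support lies in the support of `per_k`.

1. No exponent of `a` touches a cell off `S × T`: a cell `(p, q)` with `p ∉ S` would make the row
   sum of `p` positive (columns alike).
2. ONE PROJECTION (`IsProjection.complexity_le_holds`): enumerate `S` and `T` by `Fin k`
   (`Finset.orderIsoOfFin`), send the cell `(eS s, eT t)` to `X (s, t)` and every cell off `S × T`
   to `1`.  Then `c · x^m ↦ c · x^{m'}` with `m' (s, t) = m (eS s, eT t)` (`aeval_prj_monomial`),
   and `m ↦ m'` is injective on exponents living on `S × T`, so the support of the image is the
   bijective image of `supp a` (`mem_support_sum_monomial_iff`, `Finset.card_nbij`).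
3. Each `m'` has all row sums and all column sums `1`, hence is a permutation matrix `μ_σ`
   (`exists_permMonomial_eq_of_margins`), and `coeff μ_σ per_k = 1 ≠ 0`
   (`coeff_permMonomial_perPoly`).  [folklore]
-/

noncomputable section

open MvPolynomial Literature.Computability.AlgebraicComplexity
open scoped NNReal BigOperators

set_option linter.dupNamespace false

namespace Summit.ValiantsHypothesis.ValiantsHypothesis.Theorems.DivisionGap.PerMultiplesHard.BoardCompression

variable {n k : ℕ} {S T : Finset (Fin n)}

/-! ### The projection onto the `k`-board, by specification -/

/-- A projection sending the cell `(eS s, eT t)` to `X (s, t)` and every cell off `S × T` to `1`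
maps `c · x^m` to `c · x^{m'}` whenever `m` restricted to `S × T` transports to `m'`. [folklore] -/
theorem aeval_prj_monomial (eS : Fin k ≃ {x // x ∈ S}) (eT : Fin k ≃ {x // x ∈ T})
    (prj : Fin n × Fin n → MvPolynomial (Fin k × Fin k) ℝ≥0)
    (hpX : ∀ s t, prj ((eS s : Fin n), (eT t : Fin n)) = X (s, t))
    (hp1 : ∀ e : Fin n × Fin n, ¬ (e.1 ∈ S ∧ e.2 ∈ T) → prj e = 1)
    {m : (Fin n × Fin n) →₀ ℕ} {m' : (Fin k × Fin k) →₀ ℕ}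
    (hmm : ∀ s t, m ((eS s : Fin n), (eT t : Fin n)) = m' (s, t)) (c : ℝ≥0) :
    aeval prj (monomial m c) = C c * monomial m' 1 := by
  -- adapted from `BlockProjection.aeval_prj_monomial` (same tree, line `uncharged-face-walk`)
  classical
  rw [aeval_monomial, algebraMap_eq, Finsupp.prod_fintype _ _ (fun _ => pow_zero _)]
  congr 1
  rw [monomial_eq, C_1, one_mul, Finsupp.prod_fintype _ _ (fun _ => pow_zero _),
    ← Finset.prod_mul_prod_compl (S ×ˢ T), Finset.prod_eq_one (s := (S ×ˢ T)ᶜ), mul_one,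
    Finset.prod_product, Fintype.prod_prod_type, ← Finset.prod_coe_sort S, ← eS.prod_comp]
  · refine Fintype.prod_congr _ _ fun s => ?_
    rw [← Finset.prod_coe_sort T, ← eT.prod_comp]
    exact Fintype.prod_congr _ _ fun t => by rw [hpX, hmm]
  · intro e he
    rw [hp1 e (fun h => Finset.mem_compl.1 he (Finset.mem_product.2 h)), one_pow]

/-! ### Supports of sums of monomials with distinct exponents -/

/-- The support of `Σ_{x ∈ s} c_x · X^{f x}`, for `f` injective on `s` and all `c_x ≠ 0`, is the
image of `s` under `f`. [folklore] -/
theorem mem_support_sum_monomial_iff {α τ R : Type*} [CommSemiring R] {s : Finset α}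
    {f : α → (τ →₀ ℕ)} {c : α → R} (hf : Set.InjOn f s) (hc : ∀ x ∈ s, c x ≠ 0) (d : τ →₀ ℕ) :
    d ∈ (∑ x ∈ s, monomial (f x) (c x)).support ↔ ∃ x ∈ s, f x = d := by
  classical
  rw [mem_support_iff, coeff_sum]
  simp only [coeff_monomial]
  constructor
  · intro h
    obtain ⟨x, hx, hne⟩ := Finset.exists_ne_zero_of_sum_ne_zero h
    exact ⟨x, hx, of_not_not fun hfx => hne (if_neg hfx)⟩
  · rintro ⟨x, hx, rfl⟩
    rw [Finset.sum_eq_single_of_mem x hx fun y hy hyx => if_neg fun hfy => hyx (hf hy hx hfy),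
      if_pos rfl]
    exact hc x hx

/-! ### Exponents with unit margins are permutation matrices -/

/-- An exponent on the `k × k` board all of whose row sums and column sums are `1` is a
permutation matrix `μ_σ`. [folklore] -/
theorem exists_permMonomial_eq_of_margins (d : (Fin k × Fin k) →₀ ℕ)
    (hrow : ∀ s, ∑ t, d (s, t) = 1) (hcol : ∀ t, ∑ s, d (s, t) = 1) :
    ∃ σ : Equiv.Perm (Fin k), permMonomial σ = d := by
  -- adapted from `ForgivenCollisions.exists_permMonomial_eq_of_counts_le_one` (same tree)
  -- the row of the unique variable in each column
  have hex : ∀ t, ∃ r, d (r, t) ≠ 0 := fun t => by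
    by_contra h
    push Not at h
    have h0 : ∑ s, d (s, t) = 0 := Finset.sum_eq_zero fun r _ => h r
    rw [hcol] at h0
    exact one_ne_zero h0
  choose g hg using hex
  have hle_row : ∀ r t t', t ≠ t' → d (r, t) + d (r, t') ≤ 1 := fun r t t' htt' =>
    (Finset.add_le_sum (f := fun c => d (r, c)) (fun _ _ => Nat.zero_le _) (Finset.mem_univ t)
      (Finset.mem_univ t') htt').trans (hrow r).le
  have hle_col : ∀ t r r', r ≠ r' → d (r, t) + d (r', t) ≤ 1 := fun t r r' hrr' =>
    (Finset.add_le_sum (f := fun r => d (r, t)) (fun _ _ => Nat.zero_le _) (Finset.mem_univ r)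
      (Finset.mem_univ r') hrr').trans (hcol t).le
  have hg_inj : Function.Injective g := by
    intro t t' htt'
    by_contra hne
    have h1 : 1 ≤ d (g t, t) := Nat.one_le_iff_ne_zero.mpr (hg t)
    have h1' : 1 ≤ d (g t, t') := by
      rw [htt']
      exact Nat.one_le_iff_ne_zero.mpr (hg t')
    have := hle_row (g t) t t' hne
    omega
  refine ⟨Equiv.ofBijective g (Finite.injective_iff_bijective.mp hg_inj), ?_⟩
  ext ⟨r, c⟩
  rw [permMonomial_apply, Equiv.ofBijective_apply]
  have h1 : 1 ≤ d (g c, c) := Nat.one_le_iff_ne_zero.mpr (hg c)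
  have hle : d (g c, c) ≤ 1 :=
    (Finset.single_le_sum (f := fun r' => d (r', c)) (fun _ _ => Nat.zero_le _)
      (Finset.mem_univ (g c))).trans (hcol c).le
  split_ifs with h
  · subst h
    omega
  · have := hle_col c (g c) r h
    omega

/-! ### The stub -/

/-- **Board compression (stub `stub_boardCompression` of line `uncharged-face-walk`).**  If every
monomial of `a` (on the `n × n` board, over `ℝ≥0`) has row margins `𝟙_S` and column margins `𝟙_T`
with `#S = #T = k`, then some `a'` on the `k × k` board has `supp a' ⊆ supp per_k`, the same
number of monomials, and `L(a') ≤ L(a)`: `a'` is the image of `a` under the projection sending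
`S × T` (enumerated by `Fin k × Fin k`) to the variables of the small board and every other cell
to `1`; projections are free, the induced map on exponents is injective on `supp a`, and an
exponent with unit margins is a permutation matrix. [folklore] -/
theorem stub_boardCompression :
    ∀ (n k : ℕ) (S T : Finset (Fin n)) (a : MvPolynomial (Fin n × Fin n) ℝ≥0), S.card = k →
      T.card = k →
      (∀ m ∈ a.support, (∀ i, ∑ j, m (i, j) = if i ∈ S then 1 else 0) ∧
        (∀ j, ∑ i, m (i, j) = if j ∈ T then 1 else 0)) →
      ∃ a' : MvPolynomial (Fin k × Fin k) ℝ≥0, a'.support ⊆ (perPoly (Fin k) ℝ≥0).support ∧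
        a'.support.card = a.support.card ∧ complexity a' ≤ complexity a := by
  intro n k S T a hS hT hmarg
  classical
  -- enumerations of `S` and `T`
  set eS : Fin k ≃ {x // x ∈ S} := (S.orderIsoOfFin hS).toEquiv
  set eT : Fin k ≃ {x // x ∈ T} := (T.orderIsoOfFin hT).toEquiv
  -- (1) cells off `S × T` carry no exponent
  have hoff : ∀ m ∈ a.support, ∀ e : Fin n × Fin n, ¬ (e.1 ∈ S ∧ e.2 ∈ T) → m e = 0 := by
    intro m hm e he
    obtain ⟨p, q⟩ := e
    by_cases hp : p ∈ S
    · have hq : q ∉ T := fun hq => he ⟨hp, hq⟩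
      have h0 := (hmarg m hm).2 q
      rw [if_neg hq] at h0
      exact Finset.sum_eq_zero_iff.1 h0 p (Finset.mem_univ _)
    · have h0 := (hmarg m hm).1 p
      rw [if_neg hp] at h0
      exact Finset.sum_eq_zero_iff.1 h0 q (Finset.mem_univ _)
  -- the pullback of exponents to the small board, by specification
  obtain ⟨pb, hpb⟩ : ∃ pb : ((Fin n × Fin n) →₀ ℕ) → ((Fin k × Fin k) →₀ ℕ),
      ∀ m s t, pb m (s, t) = m ((eS s : Fin n), (eT t : Fin n)) :=
    ⟨fun m => Finsupp.equivFunOnFinite.symm fun st => m ((eS st.1 : Fin n), (eT st.2 : Fin n)),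
      fun _ _ _ => rfl⟩
  -- (2) the projection, by specification
  obtain ⟨prj, hpX, hp1, hpP⟩ : ∃ prj : Fin n × Fin n → MvPolynomial (Fin k × Fin k) ℝ≥0,
      (∀ s t, prj ((eS s : Fin n), (eT t : Fin n)) = X (s, t)) ∧
      (∀ e : Fin n × Fin n, ¬ (e.1 ∈ S ∧ e.2 ∈ T) → prj e = 1) ∧
      ∀ e, (∃ v, prj e = X v) ∨ ∃ c, prj e = C c := by
    refine ⟨fun e => if hx : e.1 ∈ S ∧ e.2 ∈ T then
      X (eS.symm ⟨e.1, hx.1⟩, eT.symm ⟨e.2, hx.2⟩) else 1, fun s t => ?_, fun e he => dif_neg he,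
      fun e => ?_⟩
    · dsimp only
      rw [dif_pos ⟨(eS s).2, (eT t).2⟩]
      simp
    · dsimp only
      by_cases he : e.1 ∈ S ∧ e.2 ∈ T
      · exact Or.inl ⟨_, dif_pos he⟩
      · exact Or.inr ⟨1, by rw [dif_neg he, C_1]⟩
  -- the pullback is injective on the exponents of `a`
  have hinj : Set.InjOn pb a.support := by
    intro m₁ hm₁ m₂ hm₂ heq
    ext ⟨p, q⟩
    by_cases h : p ∈ S ∧ q ∈ T
    · have h' := DFunLike.congr_fun heq (eS.symm ⟨p, h.1⟩, eT.symm ⟨q, h.2⟩)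
      simpa [hpb] using h'
    · rw [hoff m₁ hm₁ _ h, hoff m₂ hm₂ _ h]
  -- the pulled-back exponents have unit margins
  have hrow : ∀ m ∈ a.support, ∀ s, ∑ t, pb m (s, t) = 1 := by
    intro m hm s
    have h1 := (hmarg m hm).1 (eS s)
    rw [if_pos (eS s).2] at h1
    calc ∑ t, pb m (s, t) = ∑ t : Fin k, m ((eS s : Fin n), (eT t : Fin n)) := by simp only [hpb]
      _ = ∑ q : {x // x ∈ T}, m ((eS s : Fin n), (q : Fin n)) :=
          eT.sum_comp (fun q : {x // x ∈ T} => m ((eS s : Fin n), (q : Fin n)))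
      _ = ∑ q ∈ T, m ((eS s : Fin n), q) :=
          Finset.sum_coe_sort T (fun q => m ((eS s : Fin n), q))
      _ = ∑ q, m ((eS s : Fin n), q) :=
          Finset.sum_subset (Finset.subset_univ T) fun q _ hq =>
            hoff m hm ((eS s : Fin n), q) fun h => hq h.2
      _ = 1 := h1
  have hcol : ∀ m ∈ a.support, ∀ t, ∑ s, pb m (s, t) = 1 := by
    intro m hm t
    have h1 := (hmarg m hm).2 (eT t)
    rw [if_pos (eT t).2] at h1
    calc ∑ s, pb m (s, t) = ∑ s : Fin k, m ((eS s : Fin n), (eT t : Fin n)) := by simp only [hpb]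
      _ = ∑ p : {x // x ∈ S}, m ((p : Fin n), (eT t : Fin n)) :=
          eS.sum_comp (fun p : {x // x ∈ S} => m ((p : Fin n), (eT t : Fin n)))
      _ = ∑ p ∈ S, m (p, (eT t : Fin n)) :=
          Finset.sum_coe_sort S (fun p => m (p, (eT t : Fin n)))
      _ = ∑ p, m (p, (eT t : Fin n)) :=
          Finset.sum_subset (Finset.subset_univ S) fun p _ hp =>
            hoff m hm (p, (eT t : Fin n)) fun h => hp h.1
      _ = 1 := h1
  -- the image of `a` as a sum of monomials
  have hsum : aeval prj a = ∑ m ∈ a.support, monomial (pb m) (coeff m a) := by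
    conv_lhs => rw [a.as_sum]
    rw [map_sum]
    refine Finset.sum_congr rfl fun m _ => ?_
    rw [aeval_prj_monomial eS eT prj hpX hp1 (fun s t => (hpb m s t).symm) (coeff m a),
      C_mul_monomial, mul_one]
  have hmem : ∀ d, d ∈ (aeval prj a).support ↔ ∃ m ∈ a.support, pb m = d := fun d => by
    rw [hsum]
    exact mem_support_sum_monomial_iff hinj (fun m hm => mem_support_iff.1 hm) d
  refine ⟨aeval prj a, fun d hd => ?_, ?_, IsProjection.complexity_le_holds ⟨prj, hpP, rfl⟩⟩
  · -- (3) support inside `supp per_k`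
    obtain ⟨m, hm, rfl⟩ := (hmem d).1 hd
    obtain ⟨σ, hσ⟩ := exists_permMonomial_eq_of_margins (pb m) (hrow m hm) (hcol m hm)
    rw [mem_support_iff, ← hσ, coeff_permMonomial_perPoly]
    exact one_ne_zero
  · -- same number of monomials
    symm
    refine Finset.card_nbij pb (fun m hm => (hmem _).2 ⟨m, hm, rfl⟩) hinj fun d hd => ?_
    obtain ⟨m, hm, rfl⟩ := (hmem d).1 hd
    exact ⟨m, hm, rfl⟩

end Summit.ValiantsHypothesis.ValiantsHypothesis.Theorems.DivisionGap.PerMultiplesHard.BoardCompression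

end
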